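import Summits.AtomisticToContinuum.Crystallization.Theorems.HullExactificationCascadeHcpLandscapeGapStubRelaxedColumn
import Summits.AtomisticToContinuum.Crystallization.Theorems.HullExactificationCascadeHcpLandscapeGapStubSiteEnergyHeights

/-!
# Crux `HcpLandscapeGap` (stmt-AtomisticToContinuum-12087), line `registered` (birth): stub X5
# `stub_windowColumnSum` — the WINDOW COLUMN SUM

STUB X5 of the relaxed-Barlow cut of stub T (`Cruxes/HcpLandscapeGap/Lines/birth.lean`, lead
c6): summing the RELAXED COLUMN INEQUALITY (`stub_relaxedColumn`, RC) over a fibre decomposition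
of a ball window of a Barlow multilattice.

Setting.  `S = barlowStackingH a' H s` (in-layer scale `a' ∈ [47/50, 1]`, Hägg word `s`,
heights `H` with every spacing in `[39a'/50, 17a'/20]`); `y : Fin n → ℝ³` enumerates
injectively the window `W = S ∩ B̄_L(c)`; `(F, M₁, M₂, ι)` is a fibre decomposition of `W` (the
conclusion of `stub_fibreDecomposition`): the fibre `f` at layer `k` is the site
`barlowPosH a' H s k (ι f k).1 (ι f k).2`, the sites with `k ∈ [M₁ f, M₂ f]` lie in `W`,
`ι (·, k)` is injective, and every point of `W` not of this form lies within depth `5` of the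
boundary sphere.

Claim.  With `e⋆ = e_LJ(hcp a h)` at B's box minimiser `(a, h)`,
`σ̂(p) = Σ'_{z ∈ S, z ≠ p} V_LJ(dist p z)` and the `(g, C)` of RC, `C' = max C 0`:

  `n · 2e⋆ + g · Σ_{f ∈ F} Σ_{k = M₁ f}^{M₂ f} price(k) ≤ Σ_i σ̂(y i) + C' · (#F + #boundary + 1)`.

Proof (pure bookkeeping, `WindowColumnSum.assembly`).  (1) `Σ_i σ̂(y i) = Σ_{p ∈ Wf} σ̂(p)`
over the finset `Wf = image y univ`, `#Wf = n`.  (2) The covered part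
`Cov = image site (F.sigma Icc)` is a subfinset of `Wf` on which `site` is injective (different
layers give different heights; in one layer `ι (·, k)` is injective;
`SiteEnergyHeights.barlowPosH_injective`), so `Σ_{Cov} σ̂ = Σ_f Σ_k σ̂(site f k)`, and
`σ̂(site f k)` is the layer form of RS (`stub_siteEnergyHeights`), i.e. exactly the summand of
RC; RC per fibre (empty fibres contribute `0`) gives `Σ_{Cov} (σ̂ − 2e⋆) ≥ g ΣΣ price − #F · C'`.
(3) An uncovered `p ∈ Wf ∖ Cov` lies in the boundary shell (third fibre hypothesis), a subset of
the finite window, and `σ̂(p) − 2e⋆ ≥ −C'` (RC with `M₁ = M₂`, dropping `g · price ≥ 0`).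
(4) `#Wf = #Cov + #(Wf ∖ Cov)`; add up.  All [folklore].
-/

noncomputable section

namespace Summit.AtomisticToContinuum.Crystallization.Theorems.HcpLandscapeGapBirth

open Literature.MathematicalPhysics.StatisticalMechanics
open Summit.AtomisticToContinuum.Crystallization.Theorems

namespace WindowColumnSum

/-- **Abstract assembly of the window column sum.**  Points `pos k i j` of a set `S`
(injective parametrisation by `ℤ³`, exhausting `S`), a "site energy" `σ` with
`σ (pos k i j) = layerE k`, a column inequality
`(M₂ − M₁ + 1) · 2e + g Σ_{[M₁, M₂]} price ≤ Σ_{[M₁, M₂]} layerE + C` (`g, C ≥ 0`, `price ≥ 0`),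
an injective enumeration `y` of the window `{p ∈ S | ball p}` and a fibre decomposition
`(F, M₁, M₂, ι)` of the window up to the boundary `bdy`: then
`n · 2e + g Σ_f Σ_{k ∈ [M₁ f, M₂ f]} price k ≤ Σ_i σ (y i) + C (#F + #{p ∈ S, ball p, bdy p} + 1)`.
[folklore] -/
theorem assembly {E : Type*} (S : Set E) (ball bdy : E → Prop) (σ : E → ℝ)
    (pos : ℤ → ℤ → ℤ → E) (layerE price : ℤ → ℝ) {e g C : ℝ} (hg : 0 ≤ g) (hC : 0 ≤ C)
    (hprice : ∀ k, 0 ≤ price k)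
    (hRC : ∀ M₁ M₂ : ℤ, M₁ ≤ M₂ → ((M₂ - M₁ + 1 : ℤ) : ℝ) * (2 * e) +
        g * (∑ m ∈ Finset.Icc M₁ M₂, price m) ≤ (∑ m ∈ Finset.Icc M₁ M₂, layerE m) + C)
    (hRS : ∀ k i j, σ (pos k i j) = layerE k)
    (hinj : ∀ k i j k' i' j', pos k i j = pos k' i' j' → k = k' ∧ i = i' ∧ j = j')
    (hposS : ∀ k i j, pos k i j ∈ S)
    (hS : ∀ p ∈ S, ∃ k i j, p = pos k i j)
    {n : ℕ} (y : Fin n → E) (hy : Function.Injective y)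
    (hrange : Set.range y = {p | p ∈ S ∧ ball p})
    (F : Finset (ℤ × ℤ)) (M₁ M₂ : ℤ × ℤ → ℤ) (ι : ℤ × ℤ → ℤ → ℤ × ℤ)
    (hι : ∀ k, Function.Injective (fun f => ι f k))
    (hin : ∀ f ∈ F, ∀ k, M₁ f ≤ k → k ≤ M₂ f → ball (pos k (ι f k).1 (ι f k).2))
    (hcov : ∀ k i j, ball (pos k i j) →
      (∃ f ∈ F, M₁ f ≤ k ∧ k ≤ M₂ f ∧ ι f k = (i, j)) ∨ bdy (pos k i j)) :
    (n : ℝ) * (2 * e) + g * (∑ f ∈ F, ∑ k ∈ Finset.Icc (M₁ f) (M₂ f), price k) ≤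
      (∑ i, σ (y i)) + C * ((F.card : ℝ) + (Set.ncard {p | p ∈ S ∧ ball p ∧ bdy p} : ℝ) + 1) := by
  classical
  -- the window as a finset
  set W : Finset E := Finset.univ.image y with hW
  have hmemW : ∀ p, p ∈ W ↔ p ∈ S ∧ ball p := by
    intro p
    rw [hW, Finset.mem_image]
    constructor
    · rintro ⟨i, -, rfl⟩
      have : y i ∈ Set.range y := ⟨i, rfl⟩
      rw [hrange] at this
      exact this
    · intro hp
      have : p ∈ Set.range y := by rw [hrange]; exact hp
      obtain ⟨i, rfl⟩ := this
      exact ⟨i, Finset.mem_univ _, rfl⟩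
  have hcardW : W.card = n := by
    rw [hW, Finset.card_image_of_injective _ hy, Finset.card_univ, Fintype.card_fin]
  have hsumW : ∑ i, σ (y i) = ∑ p ∈ W, σ p := by
    rw [hW, Finset.sum_image hy.injOn]
  -- the covered part
  set D : Finset (Σ _ : ℤ × ℤ, ℤ) := F.sigma fun f => Finset.Icc (M₁ f) (M₂ f) with hD
  set site : (Σ _ : ℤ × ℤ, ℤ) → E := fun fk => pos fk.2 (ι fk.1 fk.2).1 (ι fk.1 fk.2).2 with hsite
  have hDinj : Set.InjOn site ↑D := by
    rintro ⟨f, k⟩ - ⟨f', k'⟩ - hff'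
    obtain ⟨hk, h1, h2⟩ := hinj _ _ _ _ _ _ hff'
    subst hk
    have : ι f k = ι f' k := Prod.ext h1 h2
    have hf : f = f' := hι k this
    subst hf
    rfl
  set Cov : Finset E := D.image site with hCov
  have hCovW : Cov ⊆ W := by
    intro p hp
    rw [hCov, Finset.mem_image] at hp
    obtain ⟨⟨f, k⟩, hfk, rfl⟩ := hp
    rw [hD, Finset.mem_sigma, Finset.mem_Icc] at hfk
    exact (hmemW _).2 ⟨hposS _ _ _, hin f hfk.1 k hfk.2.1 hfk.2.2⟩
  -- sum over the covered part
  have hsumCov : ∑ p ∈ Cov, (σ p - 2 * e) =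
      ∑ f ∈ F, ∑ k ∈ Finset.Icc (M₁ f) (M₂ f), (layerE k - 2 * e) := by
    rw [hCov, Finset.sum_image hDinj, hD, Finset.sum_sigma]
    refine Finset.sum_congr rfl fun f _ => Finset.sum_congr rfl fun k _ => ?_
    rw [hsite, hRS]
  -- per fibre column inequality
  have hcol : ∀ f ∈ F, g * (∑ k ∈ Finset.Icc (M₁ f) (M₂ f), price k) - C ≤
      ∑ k ∈ Finset.Icc (M₁ f) (M₂ f), (layerE k - 2 * e) := by
    intro f _
    rcases le_or_gt (M₁ f) (M₂ f) with hM | hM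
    · have h1 := hRC (M₁ f) (M₂ f) hM
      have hcard : ((M₂ f - M₁ f + 1 : ℤ) : ℝ) = ((Finset.Icc (M₁ f) (M₂ f)).card : ℝ) := by
        have h3 := Int.card_Icc_of_le (M₁ f) (M₂ f) (by omega)
        have h2 : ((M₂ f - M₁ f + 1 : ℤ) : ℝ) =
            (((Finset.Icc (M₁ f) (M₂ f)).card : ℤ) : ℝ) := by
          rw [h3]; push_cast; ring
        rw [h2, Int.cast_natCast]
      rw [Finset.sum_sub_distrib, Finset.sum_const, nsmul_eq_mul, ← hcard]
      linarith
    · rw [Finset.Icc_eq_empty_of_lt hM]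
      simp only [Finset.sum_empty, mul_zero, zero_sub]
      linarith
  -- uncovered part
  have hUnc : ∀ p ∈ W \ Cov, bdy p ∧ -C ≤ σ p - 2 * e := by
    intro p hp
    rw [Finset.mem_sdiff] at hp
    obtain ⟨hpS, hpball⟩ := (hmemW p).1 hp.1
    obtain ⟨k, i, j, rfl⟩ := hS p hpS
    constructor
    · rcases hcov k i j hpball with ⟨f, hfF, h1, h2, h3⟩ | hb
      · exfalso
        apply hp.2
        rw [hCov, Finset.mem_image]
        refine ⟨⟨f, k⟩, ?_, ?_⟩
        · rw [hD, Finset.mem_sigma, Finset.mem_Icc]; exact ⟨hfF, h1, h2⟩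
        · simp only [hsite, h3]
      · exact hb
    · have h1 := hRC k k le_rfl
      simp only [Finset.Icc_self, Finset.sum_singleton, sub_self, zero_add, Int.cast_one,
        one_mul] at h1
      have h2 : 0 ≤ g * price k := mul_nonneg hg (hprice k)
      rw [hRS]
      linarith
  -- finiteness of the boundary set and the card bound
  have hBfin : {p | p ∈ S ∧ ball p ∧ bdy p}.Finite := by
    refine (Set.finite_range y).subset ?_
    intro p hp
    rw [hrange]
    exact ⟨hp.1, hp.2.1⟩
  have hcardUnc : ((W \ Cov).card : ℝ) ≤ (Set.ncard {p | p ∈ S ∧ ball p ∧ bdy p} : ℝ) := by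
    have hsub : (↑(W \ Cov) : Set E) ⊆ {p | p ∈ S ∧ ball p ∧ bdy p} := by
      intro p hp
      have hp' : p ∈ W \ Cov := Finset.mem_coe.1 hp
      obtain ⟨hpS, hpball⟩ := (hmemW p).1 (Finset.mem_sdiff.1 hp').1
      exact ⟨hpS, hpball, (hUnc p hp').1⟩
    have h1 := Set.ncard_le_ncard hsub hBfin
    rw [Set.ncard_coe_finset] at h1
    exact_mod_cast h1
  -- sum over the uncovered part
  have hsumUnc : -C * ((W \ Cov).card : ℝ) ≤ ∑ p ∈ W \ Cov, (σ p - 2 * e) := by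
    have h1 := Finset.card_nsmul_le_sum (W \ Cov) (fun p => σ p - 2 * e) (-C)
      fun p hp => (hUnc p hp).2
    rw [nsmul_eq_mul] at h1
    linarith
  -- assemble
  have hsplit : ∑ p ∈ W, (σ p - 2 * e) =
      ∑ p ∈ W \ Cov, (σ p - 2 * e) + ∑ p ∈ Cov, (σ p - 2 * e) :=
    (Finset.sum_sdiff hCovW).symm
  have hsumW' : ∑ p ∈ W, (σ p - 2 * e) = ∑ p ∈ W, σ p - n * (2 * e) := by
    rw [Finset.sum_sub_distrib, Finset.sum_const, nsmul_eq_mul, hcardW]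
  have hcolsum : g * (∑ f ∈ F, ∑ k ∈ Finset.Icc (M₁ f) (M₂ f), price k) - C * F.card ≤
      ∑ f ∈ F, ∑ k ∈ Finset.Icc (M₁ f) (M₂ f), (layerE k - 2 * e) := by
    have h1 := Finset.sum_le_sum hcol
    rw [Finset.sum_sub_distrib, Finset.sum_const, nsmul_eq_mul, ← Finset.mul_sum] at h1
    linarith
  have hCU : C * ((W \ Cov).card : ℝ) ≤ C * (Set.ncard {p | p ∈ S ∧ ball p ∧ bdy p} : ℝ) :=
    mul_le_mul_of_nonneg_left hcardUnc hC
  rw [hsumW]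
  linarith [hsplit, hsumW', hcolsum, hsumUnc, hCU, hsumCov]

end WindowColumnSum

/-- **Stub X5 — the window column sum.**  At B's box minimiser `(a, h)` there are `g > 0` and
`C` such that for every Barlow multilattice `barlowStackingH a' H s` on the box
(`a' ∈ [47/50, 1]`, `s` Hägg, spacings in `[39a'/50, 17a'/20]`), every injectively enumerated
ball window `y` and every fibre decomposition `(F, M₁, M₂, ι)` of it up to depth `5`:
`n · 2e_LJ(hcp a h) + g Σ_{f ∈ F} Σ_{k = M₁ f}^{M₂ f} price k`
`≤ Σ_i Σ'_{z ≠ y i} V_LJ(dist (y i) z) + C (#F + #(boundary shell of depth 5) + 1)`,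
`price k = [s (k+1) = s k] + (a' − a)² + (H (k+1) − H k − h)²`
(the relaxed column inequality `stub_relaxedColumn` summed over the fibres, the site energies in
the layer form of `stub_siteEnergyHeights`, uncovered points charged to the boundary shell;
`WindowColumnSum.assembly`). [folklore] -/
theorem stub_windowColumnSum : ∀ (a h : ℝ) (ha : a ≠ 0) (hh : h ≠ 0), (9 / 10 < a ∧ a < 1 ∧ |h - a * Real.sqrt (2 / 3)| ≤ a / 100) → (∀ a' h' : ℝ, ∀ ha' : a' ≠ 0, ∀ hh' : h' ≠ 0, (9 / 10 < a' ∧ a' < 1 ∧ |h' - a' * Real.sqrt (2 / 3)| ≤ a' / 100) → (Literature.MathematicalPhysics.StatisticalMechanics.hcpPeriodicConfiguration ha hh).energyPerParticle Literature.MathematicalPhysics.StatisticalMechanics.lennardJones ≤ (Literature.MathematicalPhysics.StatisticalMechanics.hcpPeriodicConfiguration ha' hh').energyPerParticle Literature.MathematicalPhysics.StatisticalMechanics.lennardJones) → ∃ g : ℝ, 0 < g ∧ ∃ C : ℝ, ∀ a' : ℝ, 47 / 50 ≤ a' → a' ≤ 1 → ∀ s : ℤ → ℤ, Literature.MathematicalPhysics.StatisticalMechanics.IsHaggSeq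 s → ∀ H : ℤ → ℝ, (∀ k : ℤ, 39 / 50 * a' ≤ H (k + 1) - H k ∧ H (k + 1) - H k ≤ 17 / 20 * a') → ∀ (c : EuclideanSpace ℝ (Fin 3)) (L : ℝ) (n : ℕ) (y : Fin n → EuclideanSpace ℝ (Fin 3)), Function.Injective y → Set.range y = {p : EuclideanSpace ℝ (Fin 3) | p ∈ Literature.MathematicalPhysics.StatisticalMechanics.barlowStackingH a' H s ∧ dist p c ≤ L} → ∀ (F : Finset (ℤ × ℤ)) (M₁ M₂ : ℤ × ℤ → ℤ) (ι : ℤ × ℤ → ℤ → ℤ × ℤ), (∀ k : ℤ, Function.Injective (fun f : ℤ × ℤ => ι f k)) → (∀ f ∈ F, ∀ k : ℤ, M₁ f ≤ k → k ≤ M₂ f → dist (Literature.MathematicalPhysics.StatisticalMechanics.barlowPosH a' H s k (ι f k).1 (ι f k).2) c ≤ L) → (∀ k i j : ℤ, dist (Literature.MathematicalPhysics.StatisticalMechanics.barlowPosH a' H s k i j) c ≤ L → (∃ f ∈ F, M₁ f ≤ k ∧ k ≤ M₂ f ∧ ι f k = (i, j)) ∨ L - 5 < dist (Literature.MathematicalPhysics.StatisticalMechanics.barlowPosH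 a' H s k i j) c) → (n : ℝ) * (2 * (Literature.MathematicalPhysics.StatisticalMechanics.hcpPeriodicConfiguration ha hh).energyPerParticle Literature.MathematicalPhysics.StatisticalMechanics.lennardJones) + g * (∑ f ∈ F, ∑ k ∈ Finset.Icc (M₁ f) (M₂ f), ((if s (k + 1) = s k then (1 : ℝ) else 0) + (a' - a) ^ 2 + (H (k + 1) - H k - h) ^ 2)) ≤ (∑ i : Fin n, (∑' z : ↥{z : EuclideanSpace ℝ (Fin 3) | z ∈ Literature.MathematicalPhysics.StatisticalMechanics.barlowStackingH a' H s ∧ z ≠ y i}, Literature.MathematicalPhysics.StatisticalMechanics.lennardJones (dist (y i) (z : EuclideanSpace ℝ (Fin 3))))) + C * ((F.card : ℝ) + (Set.ncard {p : EuclideanSpace ℝ (Fin 3) | p ∈ Literature.MathematicalPhysics.StatisticalMechanics.barlowStackingH a' H s ∧ dist p c ≤ L ∧ L - 5 < dist p c} : ℝ) + 1) := by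
  intro a h ha hh hbox hmin
  obtain ⟨g, hg, C, hRC⟩ := stub_relaxedColumn a h ha hh hbox hmin
  refine ⟨g, hg, max C 0, ?_⟩
  intro a' ha' ha'1 s hs H hH c L n y hy hrange F M₁ M₂ ι hι hin hcov
  have ha'0 : 0 < a' := by linarith
  have hgap0 : 0 < 39 / 50 * a' := by positivity
  have hgap : ∀ k : ℤ, 39 / 50 * a' ≤ H (k + 1) - H k := fun k => (hH k).1
  have hinj3 := SiteEnergyHeights.barlowPosH_injective ha'0 hgap0 hgap s
  exact WindowColumnSum.assembly (barlowStackingH a' H s) (fun p => dist p c ≤ L)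
    (fun p => L - 5 < dist p c)
    (fun p => ∑' z : ↥{z : EuclideanSpace ℝ (Fin 3) | z ∈ barlowStackingH a' H s ∧ z ≠ p},
      lennardJones (dist p (z : EuclideanSpace ℝ (Fin 3))))
    (barlowPosH a' H s)
    (fun m => inLayerInteraction lennardJones a' + ∑' k : ℤ, (if k = m then (0 : ℝ) else
      layerInteraction lennardJones a' (H k - H m) (haggLabel s k - haggLabel s m) 1))
    (fun k => (if s (k + 1) = s k then (1 : ℝ) else 0) + (a' - a) ^ 2 + (H (k + 1) - H k - h) ^ 2)
    (e := (hcpPeriodicConfiguration ha hh).energyPerParticle lennardJones)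
    hg.le (le_max_right C 0) (fun k => by positivity)
    (fun N₁ N₂ hN => (hRC a' ha' ha'1 s hs H hH N₁ N₂ hN).trans
      (add_le_add le_rfl (le_max_left C 0)))
    (fun k i j => (stub_siteEnergyHeights a' ha' ha'1 s hs H hH k i j).2.2)
    (fun k i j k' i' j' hq => by
      have h1 := hinj3 (a₁ := (k, i, j)) (a₂ := (k', i', j')) hq
      simp only [Prod.mk.injEq] at h1
      exact h1)
    (fun k i j => barlowPosH_mem k i j) (fun p hp => mem_barlowStackingH_iff.1 hp)
    y hy hrange F M₁ M₂ ι hι hin hcov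

end Summit.AtomisticToContinuum.Crystallization.Theorems.HcpLandscapeGapBirth

end
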